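import Literature.AlgebraicGeometry.Milne1999.TateFromCodesHCOfHSimplePos
import Literature.AlgebraicGeometry.Milne1999.TateFromCodesHCOfRiemann
import HarnessLib

/-!
# COR-CM model layer (b11, row B03): CM domination by the Picard–CM codes — the unguarded binder is
# false, the guarded one is Riemann's

Cell `pub-hodgecm2` (COR-CM), seat `b11`; row B03 of `BINDER-OWNERS.md` (the `dom` input of the E term's A3
arrow, `CorCM/DictionaryA3.lean`).  KERNEL ONLY (three theorems; no definition, no named fact).

The edge `Milne1999.forall_cmHodgeHypothesisAt_of_codesHC (hI) (hC) (hDom) (hIso)`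
(`CMHodgeHypothesisFromRealisations`) turns the Hodge conjecture on the CM-flagged codes of the Picard–CM
universe into Milne's hypothesis (H) «the Hodge conjecture holds for all abelian varieties of CM-type over
ℂ» (Milne 1999, Thm. 7.1, p. 72), over the DOMINATION binder

  `hDom : ∀ A : AbelianVariety ℂ, IsSmoothProjective A.dim A.X → IsOfCMType A →`
  `  ∃ v B, PicardCM.Var.IsCMAbelianVariety h₃ v ∧ B.X = PicardCM.Var.scheme hU h₃ v ∧ IsIsogenous A B`

(Shimura–Taniyama: every complex abelian variety of CM-type is isogenous to a product of principal
CM-typed ones, Shimura 1998 §5.1 Props. 3–6, §6.1 Cor. of Thm. 2, §7.1 Prop. 7).  This file records: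

* `not_hDom` — **`hDom` AS TYPED IS FALSE** for every `hU`, `h₃`: the trivial abelian variety
  (`AbelianVariety.trivial ℂ`, dimension `0` by `AbelianVariety.dim_trivial`, smooth projective by
  `AbelianVariety.isSmoothProjective_holds`, of CM-type by `isOfCMType_of_dim_eq_zero`) is isogenous to no
  interpretation of a CM-flagged code, because isogenies preserve dimension (`dim_eq_of_isIsogeny`) and
  every CM-flagged code has positive dimension (`dim_pos_of_isCMAbelianVariety`: atoms `cm c` have dimension
  `[E:ℚ]/2 ≥ 1`, `E` a CM field).  This is the degeneracy `TateFromCodesHCOfHSimplePos` §2 records for the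
  binder `hSimple` (`not_hSimple`), now stated for `hDom` itself;
* `hDomPos_of_riemann` — the GUARDED binder (`0 < A.dim` in place of smooth-projectivity, i.e. the
  hypothesis `hDomPos` of `forall_cmHodgeHypothesisAt_of_codesHC_pos`) is a THEOREM modulo Riemann's theorem
  `HodgeTheory.DeligneMilne1982_Thm_6_20_full` only: `hDomPos_of_hDecompPos (thm2_cor_of_riemann hR)` ∘
  `hDecompPos_of_hSimplePos (hSimplePos_of_riemann hR)`.

Consumers wiring (H) from `CodesHC` through a displayed domination hypothesis must therefore use the guarded
form and `forall_cmHodgeHypothesisAt_of_codesHC_pos` (dimension `0` is the tree's unconditional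
`hodgeConjectureFor_of_dim_le_three_holds` there), or the Riemann form
`forall_cmHodgeHypothesisAt_of_codesHC_of_riemann` with no domination hypothesis at all.

Deliberately NOT here: any new statement of (H), of `CodesHC`, or of the Shimura–Taniyama theorem (all in
the sibling files); nothing about which abelian varieties of dimension `0` exist beyond `AbelianVariety.trivial`.

## References

* [Shimura1998] G. Shimura, *Abelian Varieties with Complex Multiplication and Modular Functions* (1998),
  §5.1 Props. 3–6, §5.2, §6.1 Thm. 2 Cor. (p. 41), §7.1 Prop. 7.
* [DeligneMilne1982Tannakian] P. Deligne, J. S. Milne, *Tannakian Categories*, LNM 900 (1982), §6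
  Thm. 6.20 (Riemann).
* [Milne1999] J. S. Milne, *Lefschetz motives and the Tate conjecture*, Compositio Math. 117 (1999), §2
  p. 54, §7 Thm. 7.1 p. 72.
-/

noncomputable section

open AlgebraicGeometry NumberField
open Literature.AlgebraicGeometry.Motives Literature.AlgebraicGeometry.HodgeTheory
open Literature.AlgebraicGeometry.ComplexMultiplication Literature.NumberTheory.Automorphic
open Literature.AlgebraicGeometry.Milne1999

namespace Summit.HodgeConjecture.CorCM.Model

/-- **A CM-flagged code of the Picard–CM universe has positive dimension**: the atoms `cm c` have
dimension `[E:ℚ]/2 ≥ 1` (`E` a CM field is totally complex, so `[E:ℚ] = 2 · #(complex places) > 0`),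
products add, and `pms`/`proj` codes are not CM-flagged. [folklore] -/
theorem dim_pos_of_isCMAbelianVariety (h₃ : PicardCM.CMAbelianVarietyRealised) :
    ∀ {v : PicardCM.Var}, PicardCM.Var.IsCMAbelianVariety h₃ v → 0 < v.dim
  | .cm c, _ => by
    have hK : Module.finrank ℚ c.E = 2 * NumberField.InfinitePlace.nrComplexPlaces c.E :=
      NumberField.IsTotallyComplex.finrank c.E
    have hpos : 0 < Module.finrank ℚ c.E := Module.finrank_pos
    simp only [PicardCM.Var.dim_cm]
    omega
  | .prod v w, h => Nat.add_pos_left (dim_pos_of_isCMAbelianVariety h₃ h.1) _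
  | .pms _, h => h.elim
  | .proj _, h => h.elim

/-- **The unguarded CM-domination binder is FALSE.**  The hypothesis `hDom` of
`forall_cmHodgeHypothesisAt_of_codesHC` as typed — every smooth projective complex abelian variety of
CM-type is isogenous to an abelian variety whose scheme interprets a CM-flagged code of the Picard–CM
universe — fails, for every `hU`, `h₃`, at the trivial abelian variety `AbelianVariety.trivial ℂ`
(dimension `0`, smooth projective, of CM-type by `isOfCMType_of_dim_eq_zero`): an isogeny preserves
dimension (`dim_eq_of_isIsogeny`) and every CM-flagged code has positive dimension
(`dim_pos_of_isCMAbelianVariety`).  The repaired binder is the guarded `hDomPos` (`0 < A.dim`), a theorem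
modulo Riemann's theorem (`hDomPos_of_riemann`). [folklore] -/
theorem not_hDom (hU : PicardCM.BallQuotientUniformisedDatum) (h₃ : PicardCM.CMAbelianVarietyRealised) :
    ¬ (∀ A : AbelianVariety ℂ, IsSmoothProjective A.dim A.X → IsOfCMType A →
      ∃ (v : PicardCM.Var) (B : AbelianVariety ℂ), PicardCM.Var.IsCMAbelianVariety h₃ v ∧
        B.X = PicardCM.Var.scheme hU h₃ v ∧ AbelianVariety.IsIsogenous A B) := by
  intro h
  obtain ⟨v, B, hv, hBX, f, hf⟩ := h (AbelianVariety.trivial ℂ) AbelianVariety.isSmoothProjective_holds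
    (isOfCMType_of_dim_eq_zero AbelianVariety.dim_trivial)
  have hdim : B.dim = v.dim := by
    rw [AbelianVariety.dim, hBX]
    exact schemeDim_eq_holds (PicardCM.Var.isSmoothProjective hU h₃ v)
  have hv0 : 0 < v.dim := dim_pos_of_isCMAbelianVariety h₃ hv
  have h0 : (AbelianVariety.trivial ℂ).dim = B.dim := AbelianVariety.dim_eq_of_isIsogeny hf
  rw [AbelianVariety.dim_trivial, hdim] at h0
  omega

/-- **Guarded CM domination is a theorem modulo Riemann's theorem.**  Every complex abelian variety of
CM-type of POSITIVE dimension is isogenous to an abelian variety whose scheme interprets a CM-flagged code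
of the Picard–CM universe — exactly the hypothesis `hDomPos` of `forall_cmHodgeHypothesisAt_of_codesHC_pos`
— granted only `HodgeTheory.DeligneMilne1982_Thm_6_20_full` (Riemann): the guarded decomposition into
CM-typed factors (`hDecompPos_of_hSimplePos` over `hSimplePos_of_riemann`: Poincaré reducibility, Shimura
§5.1 Props. 3–6, §7.1 Prop. 7) and the coding of CM-typed products (`hDomPos_of_hDecompPos` over
`thm2_cor_of_riemann`: §6.1 Cor. of Thm. 2).
[cite: Shimura1998, §5.1 Props. 3–6, §6.1 Cor. of Thm. 2 (p. 41), §7.1 Prop. 7]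
[cite: DeligneMilne1982Tannakian, §6 Thm. 6.20 (Riemann)] -/
theorem hDomPos_of_riemann (hR : DeligneMilne1982_Thm_6_20_full)
    (hU : PicardCM.BallQuotientUniformisedDatum) (h₃ : PicardCM.CMAbelianVarietyRealised) :
    ∀ A : AbelianVariety ℂ, 0 < A.dim → IsOfCMType A →
      ∃ (v : PicardCM.Var) (B : AbelianVariety ℂ), PicardCM.Var.IsCMAbelianVariety h₃ v ∧
        B.X = PicardCM.Var.scheme hU h₃ v ∧ AbelianVariety.IsIsogenous A B :=
  hDomPos_of_hDecompPos (thm2_cor_of_riemann hR) hU h₃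
    (hDecompPos_of_hSimplePos (hSimplePos_of_riemann hR))

end Summit.HodgeConjecture.CorCM.Model

end
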